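import Summits.CriticalPhenomena.PercolationContinuityZ3.Theorems.PercNearOneGluingNoHeavyLowerTailSunflowerLSMCalculus

/-!
# `NoHeavyLowerTail` (crux stmt-CriticalPhenomena-4575), abstract sunflower cubic: THE CLASS 𝓛 IS GRADEDLY SAFE

Support file (seat `prim-ineq-prove-1` gen 35; `--supports stmt-CriticalPhenomena-4575`).  No `sorry`, no named facts.
Memo: run/shared/lean/prim/prim-ineq-prove-1/FINDING-LSM-prove1-g35.md §4–§5.

* `LF` — the formula class 𝓛: leaves, conjunctions of members on disjoint supports, disjunction of a member with ONE NEW leaf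
  (equivalently: read-once formulas in which every ∨-gate has at most one non-leaf input), with `supp`, `toSet`, `fam` (its blocker).
* **`LF.gsafe`** (Theorems A, B, C of the memo): every well-formed formula of 𝓛 defines a GRADEDLY SAFE core, hence a SAFE one
  (`LF.safe`: Lemma A `∏ μ(V_i) ≤ μ(A)^{K−1}`, (C1-law), the `H/G/T` rows via `…SunflowerSafeCalculus`), for every product measure.
* `LF.gsafe_or` / `LF.safe_or`, and the class `GF` = 𝒢₁ (disjoint disjunctions of members of 𝓛) with **`GF.gsafe`** / `GF.safe`:
  by g34's `gsafe_union`, 𝒢₁-formulas define gradedly safe, hence safe, cores; with g34's `safe_inter` / `safe_union_of_gsafe` this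
  certifies SAFETY of every read-once core with ≤ 9 leaves (memo §5; ≤ 13 leaves with the paper-level merging rule).
* `gsafe_example`: `x₁ ∧ (x₂ ∨ x₃ ∧ (x₄ ∨ x₅))` — the smallest graded-safety instance left open by gen 34 — is gradedly safe;
  with `LF.safe_or` this settles the 10-leaf read-once core `x₁(x₂∨x₃(x₄∨x₅)) ∨ x₆(x₇∨x₈(x₉∨x₁₀))` (gen 34's first open (RO) case).
-/

noncomputable section

namespace Summit.CriticalPhenomena.PercolationContinuityZ3.Theorems.SunflowerPartition

namespace SafeCalc

open MeasureTheory Finset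
open Literature.Probability.LatticeModels Literature.Probability.Percolation

variable {ι : Type*} [DecidableEq ι] (p : ι → unitInterval)

/-! ## The class 𝓛 -/

/-- The formula class 𝓛: leaves, conjunctions (of formulas on disjoint supports), and disjunctions with ONE NEW leaf. [this work] -/
inductive LF (ι : Type*) : Type _
  | leaf : ι → LF ι
  | and : LF ι → LF ι → LF ι
  | orLeaf : LF ι → ι → LF ι

namespace LF

variable {p}

/-- The support (block) of a formula. [this work] -/
def supp : LF ι → Finset ι
  | leaf e => {e}
  | .and F G => F.supp ∪ G.supp
  | orLeaf F e => F.supp ∪ {e}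

/-- The up-set defined by a formula. [this work] -/
def toSet : LF ι → Set (Set ι)
  | leaf e => {ω | e ∈ ω}
  | .and F G => F.toSet ∩ G.toSet
  | orLeaf F e => F.toSet ∪ {ω | e ∈ ω}

/-- The family of minimal bad missing sets (the blocker) of a formula. [this work] -/
def fam : LF ι → Finset (Finset ι)
  | leaf e => {{e}}
  | .and F G => F.fam ∪ G.fam
  | orLeaf F e => F.fam.image fun C => C ∪ {e}

/-- Well-formedness (read-once): operands have disjoint supports, new leaves are new. [this work] -/
def WF : LF ι → Prop
  | leaf _ => True
  | .and F G => F.WF ∧ G.WF ∧ Disjoint F.supp G.supp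
  | orLeaf F e => F.WF ∧ e ∉ F.supp

omit [DecidableEq ι] in
/-- The up-set of a formula is an up-set. [this work] -/
theorem isUpperSet_toSet : ∀ F : LF ι, IsUpperSet F.toSet
  | leaf _ => fun _ _ h he => h he
  | .and F G => (isUpperSet_toSet F).inter (isUpperSet_toSet G)
  | orLeaf F _ => (isUpperSet_toSet F).union fun _ _ h he => h he

/-- The up-set of a formula is determined by its support. [this work] -/
theorem determinedBy_toSet : ∀ F : LF ι, DeterminedBy F.toSet (↑F.supp : Set ι)
  | leaf e => by
    rw [determinedBy_iff]
    intro ω ω' h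
    change e ∈ ω ↔ e ∈ ω'
    have := Set.ext_iff.1 h e
    simp only [supp, coe_singleton, Set.mem_inter_iff, Set.mem_singleton_iff, and_true] at this
    exact this
  | .and F G => by
    have hF := (determinedBy_toSet F).mono (show (↑F.supp : Set ι) ⊆ ↑(F.supp ∪ G.supp) from
      Finset.coe_subset.2 subset_union_left)
    have hG := (determinedBy_toSet G).mono (show (↑G.supp : Set ι) ⊆ ↑(F.supp ∪ G.supp) from
      Finset.coe_subset.2 subset_union_right)
    exact hF.inter hG
  | orLeaf F e => by
    have hF := (determinedBy_toSet F).mono (show (↑F.supp : Set ι) ⊆ ↑(F.supp ∪ {e}) from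
      Finset.coe_subset.2 subset_union_left)
    rw [determinedBy_iff] at hF ⊢
    intro ω ω' h
    have hE : e ∈ ω ↔ e ∈ ω' := by
      have hes : e ∈ (↑((orLeaf F e).supp) : Set ι) := by
        rw [Finset.mem_coe]; unfold supp; exact mem_union_right _ (mem_singleton_self e)
      have := Set.ext_iff.1 h e
      simp only [Set.mem_inter_iff, hes, and_true] at this
      exact this
    exact or_congr (hF ω ω' h) hE

/-- Members of the family are nonempty. [this work] -/
theorem fam_nonempty : ∀ F : LF ι, ∀ C ∈ F.fam, C.Nonempty
  | leaf e => fun C hC => by rw [fam, mem_singleton] at hC; rw [hC]; exact singleton_nonempty e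
  | .and F G => fun C hC => by
    rw [fam, mem_union] at hC
    rcases hC with h | h
    · exact fam_nonempty F C h
    · exact fam_nonempty G C h
  | orLeaf F e => fun C hC => by
    rw [fam, mem_image] at hC
    obtain ⟨C', _, rfl⟩ := hC
    exact ⟨e, mem_union_right _ (mem_singleton_self e)⟩

/-- **THEOREM B**: every well-formed formula of 𝓛 carries a log-supermodular family (its blocker). [this work] -/
theorem lsmFam : ∀ F : LF ι, F.WF → LSMFam p F.supp F.toSet F.fam
  | leaf e, _ => lsmFam_leaf p e
  | .and F G, h => lsmFam_and p h.2.2 (determinedBy_toSet F) (determinedBy_toSet G) (lsmFam F h.1) (lsmFam G h.2.1)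
  | orLeaf F _, h => lsmFam_orLeaf p h.2 (lsmFam F h.1)

/-- **Every well-formed formula of 𝓛 defines a GRADEDLY SAFE core** (Theorems A–C of the memo). [this work] -/
theorem gsafe [Fintype ι] (F : LF ι) (hF : F.WF) : GSafe p F.supp F.toSet :=
  gsafe_of_lsmFam p (determinedBy_toSet F) (isUpperSet_toSet F) (lsmFam F hF)

/-- Hence SAFE (Lemma A, (C1-law), the H/G/T rows via `…SunflowerSafeCalculus`). [this work] -/
theorem safe [Fintype ι] (F : LF ι) (hF : F.WF) : Safe p F.toSet :=
  safe_of_gsafe p F.supp (determinedBy_toSet F) (isUpperSet_toSet F) (gsafe F hF)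

/-- A disjunction of two members of 𝓛 on disjoint supports is gradedly safe (`gsafe_union`). [this work] -/
theorem gsafe_or [Fintype ι] (F G : LF ι) (hF : F.WF) (hG : G.WF) (h : Disjoint F.supp G.supp) :
    GSafe p (F.supp ∪ G.supp) (F.toSet ∪ G.toSet) :=
  gsafe_union p h (determinedBy_toSet F) (determinedBy_toSet G) (gsafe F hF) (gsafe G hG)

/-- … and safe. [this work] -/
theorem safe_or [Fintype ι] (F G : LF ι) (hF : F.WF) (hG : G.WF) (h : Disjoint F.supp G.supp) :
    Safe p (F.toSet ∪ G.toSet) := by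
  have hd : DeterminedBy (F.toSet ∪ G.toSet) (↑(F.supp ∪ G.supp) : Set ι) := by
    have hF' := (determinedBy_toSet F).mono (show (↑F.supp : Set ι) ⊆ ↑(F.supp ∪ G.supp) from
      Finset.coe_subset.2 subset_union_left)
    have hG' := (determinedBy_toSet G).mono (show (↑G.supp : Set ι) ⊆ ↑(F.supp ∪ G.supp) from
      Finset.coe_subset.2 subset_union_right)
    rw [determinedBy_iff] at hF' hG' ⊢
    intro ω ω' hω
    exact or_congr (hF' ω ω' hω) (hG' ω ω' hω)
  exact safe_of_gsafe p (F.supp ∪ G.supp) hd ((isUpperSet_toSet F).union (isUpperSet_toSet G)) (gsafe_or F G hF hG h)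

end LF

/-! ## The graded-safe class 𝒢₁: disjoint disjunctions of members of 𝓛 -/

/-- The class 𝒢₁: members of 𝓛 and disjunctions (on disjoint supports) of members of 𝒢₁. [this work] -/
inductive GF (ι : Type*) : Type _
  | base : LF ι → GF ι
  | or : GF ι → GF ι → GF ι

namespace GF

variable {p}

/-- Support of a 𝒢₁-formula. [this work] -/
def supp : GF ι → Finset ι
  | base F => F.supp
  | .or G H => G.supp ∪ H.supp

/-- Up-set of a 𝒢₁-formula. [this work] -/
def toSet : GF ι → Set (Set ι)
  | base F => F.toSet
  | .or G H => G.toSet ∪ H.toSet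

/-- Well-formedness of a 𝒢₁-formula: read-once. [this work] -/
def WF : GF ι → Prop
  | base F => F.WF
  | .or G H => G.WF ∧ H.WF ∧ Disjoint G.supp H.supp

omit [DecidableEq ι] in
/-- Up-sets of 𝒢₁-formulas are up-sets. [this work] -/
theorem isUpperSet_toSet : ∀ G : GF ι, IsUpperSet G.toSet
  | base F => LF.isUpperSet_toSet F
  | .or G H => (isUpperSet_toSet G).union (isUpperSet_toSet H)

/-- Up-sets of 𝒢₁-formulas are determined by their supports. [this work] -/
theorem determinedBy_toSet : ∀ G : GF ι, DeterminedBy G.toSet (↑G.supp : Set ι)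
  | base F => LF.determinedBy_toSet F
  | .or G H => by
    have hG := (determinedBy_toSet G).mono (show (↑G.supp : Set ι) ⊆ ↑(G.supp ∪ H.supp) from
      Finset.coe_subset.2 subset_union_left)
    have hH := (determinedBy_toSet H).mono (show (↑H.supp : Set ι) ⊆ ↑(G.supp ∪ H.supp) from
      Finset.coe_subset.2 subset_union_right)
    rw [determinedBy_iff] at hG hH ⊢
    intro ω ω' h
    exact or_congr (hG ω ω' h) (hH ω ω' h)

/-- **Every well-formed 𝒢₁-formula defines a gradedly safe core** (`LF.gsafe` + `gsafe_union`). [this work] -/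
theorem gsafe [Fintype ι] : ∀ G : GF ι, G.WF → GSafe p G.supp G.toSet
  | base F, h => LF.gsafe F h
  | .or G H, h => gsafe_union p h.2.2 (determinedBy_toSet G) (determinedBy_toSet H) (gsafe G h.1) (gsafe H h.2.1)

/-- … hence a safe one. [this work] -/
theorem safe [Fintype ι] (G : GF ι) (h : G.WF) : Safe p G.toSet :=
  safe_of_gsafe p G.supp (determinedBy_toSet G) (isUpperSet_toSet G) (gsafe G h)

end GF

/-! ## The smallest instance left open by gen 34: `x₁ ∧ (x₂ ∨ x₃ ∧ (x₄ ∨ x₅))` -/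

/-- The formula `x₁ ∧ (x₂ ∨ (x₃ ∧ (x₄ ∨ x₅)))` as a member of 𝓛 (built inside-out: `((x₅ ∨ x₄) ∧ x₃ ∨ x₂) ∧ x₁`). [this work] -/
def exampleLF (x₁ x₂ x₃ x₄ x₅ : ι) : LF ι :=
  LF.and (LF.orLeaf (LF.and (LF.orLeaf (LF.leaf x₅) x₄) (LF.leaf x₃)) x₂) (LF.leaf x₁)

omit [DecidableEq ι] in
/-- Its up-set is `{ω | x₁ ∈ ω ∧ (x₂ ∈ ω ∨ (x₃ ∈ ω ∧ (x₄ ∈ ω ∨ x₅ ∈ ω)))}`. [this work] -/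
theorem exampleLF_toSet (x₁ x₂ x₃ x₄ x₅ : ι) :
    (exampleLF x₁ x₂ x₃ x₄ x₅).toSet = {ω | x₁ ∈ ω ∧ (x₂ ∈ ω ∨ (x₃ ∈ ω ∧ (x₄ ∈ ω ∨ x₅ ∈ ω)))} := by
  ext ω
  simp only [exampleLF, LF.toSet, Set.mem_inter_iff, Set.mem_union, Set.mem_setOf_eq]
  tauto

/-- **`x₁ ∧ (x₂ ∨ x₃ ∧ (x₄ ∨ x₅))` is gradedly safe** (for five distinct coordinates, every `p`). [this work] -/
theorem gsafe_example [Fintype ι] (x₁ x₂ x₃ x₄ x₅ : ι) (h12 : x₁ ≠ x₂) (h13 : x₁ ≠ x₃) (h14 : x₁ ≠ x₄) (h15 : x₁ ≠ x₅)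
    (h23 : x₂ ≠ x₃) (h24 : x₂ ≠ x₄) (h25 : x₂ ≠ x₅) (h34 : x₃ ≠ x₄) (h35 : x₃ ≠ x₅) (h45 : x₄ ≠ x₅) :
    GSafe p (exampleLF x₁ x₂ x₃ x₄ x₅).supp {ω | x₁ ∈ ω ∧ (x₂ ∈ ω ∨ (x₃ ∈ ω ∧ (x₄ ∈ ω ∨ x₅ ∈ ω)))} := by
  rw [← exampleLF_toSet]
  refine LF.gsafe (exampleLF x₁ x₂ x₃ x₄ x₅) ?_
  refine ⟨⟨⟨⟨trivial, ?_⟩, trivial, ?_⟩, ?_⟩, trivial, ?_⟩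
  · show x₄ ∉ ({x₅} : Finset ι)
    rw [Finset.mem_singleton]; exact h45
  · show Disjoint (({x₅} : Finset ι) ∪ {x₄}) {x₃}
    rw [Finset.disjoint_singleton_right, Finset.mem_union, Finset.mem_singleton, Finset.mem_singleton, not_or]
    exact ⟨h35, h34⟩
  · show x₂ ∉ (({x₅} : Finset ι) ∪ {x₄}) ∪ {x₃}
    simp only [Finset.mem_union, Finset.mem_singleton, not_or]
    exact ⟨⟨h25, h24⟩, h23⟩
  · show Disjoint (((({x₅} : Finset ι) ∪ {x₄}) ∪ {x₃}) ∪ {x₂}) {x₁}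
    rw [Finset.disjoint_singleton_right]
    simp only [Finset.mem_union, Finset.mem_singleton, not_or]
    exact ⟨⟨⟨h15, h14⟩, h13⟩, h12⟩

end SafeCalc

end Summit.CriticalPhenomena.PercolationContinuityZ3.Theorems.SunflowerPartition
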